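import Summits.KontsevichZagierPeriods.KontsevichZagierPeriods.Theorems.LiouvilleUnfoldingAyoubPiCancellationStubStripConst
import Summits.KontsevichZagierPeriods.KontsevichZagierPeriods.Theorems.TerasomaMultiplicationBetaCancellationStubWeightExists
import Literature.NumberTheory.Transcendental.KZDominatedFamilyRelations

/-!
# Crux stmt-KontsevichZagierPeriods-0540 (`LiouvilleUnfolding.AyoubPiCancellation` ≡ `KZ.PiCancellation`),
# line `Sketch` (idea `moving-segment-wronskian`): stub `stub_spreadSolidReduce`

Support file (`--supports` stmt-KontsevichZagierPeriods-0540) of the line skeleton (v6), registered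
stub `stub_spreadSolidReduce` (M). For an interior interval `a < a' < b' < b`, `-1 < a' < b' < 1`
(rational) and a bounded weight `w` of the wall position `q`, `ℚ`-semialgebraic on `ℝ¹` and
VANISHING OFF `(a', b')` (in the stub: the zero-mean spread weight `h_{a',b'}` of
`stub_spreadWeight`, an extension by zero), every representation
`V_w = [{(q, x, y) : a < q < b, x² + y² ≤ 1, x < q}, w(q)]` of the weighted spread solid
(coordinates `z 0 = q`, `z 1 = x`, `z 2 = y`) is equivalent in the Kontsevich–Zagier calculus
(`KZCalculus.lean`) to the PLANE STAGE `K = [{(x, q) : -1 ≤ x ≤ q, a' ≤ q ≤ b'}, 2√(1 − x²) · w(q)]`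
(coordinates `z 0 = x`, `z 1 = q`). The chain of moves (`spreadSolidReduce_of_weight`):
* cut the wall positions to the slab `(a', b')` (rule (1),
  `KZ.IntegralRep.of_sub_of_slabRestrict_sub_of_slabCompl_mem`; the complement piece is a relation
  since `w = 0` off `(a', b')`, `KZ.of_mem_relations_of_eqOn_zero`);
* close `x < q` to `x ≤ q` and the slab to `[a', b']` (the difference lies in the hyperplanes
  `{x = q}`, `{q = a'}`, `{q = b'}`, a null set: `KZ.IntegralRep.of_sub_of_restrict_mem_relations`),
  reaching `V_cl = [{a' ≤ q ≤ b', x² + y² ≤ 1, x ≤ q}, w(q)]`;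
* Newton–Leibniz along the last coordinate `y` (rule (3), `KZ.newtonLeibnizRel`) over the base
  `T = {(q, x) : a' ≤ q ≤ b', -1 ≤ x ≤ q}` with edges `∓√(1 − x²)` and primitive
  `F (q, x, y) = y · w(q)` (boundary term `2√(1 − x²) · w(q)`): `V_cl ∼ K₂ = [T, 2√(1 − x²) w(q)]`;
* swap the two coordinates (rule (2), `KZ.of_sub_of_reindex_mem_relations`, `Equiv.swap 0 1`).
No definitions; namespace of the line skeleton. References: M. Kontsevich, D. Zagier, *Periods*
(2001), §1.2, rules (1)–(3); J. Bochnak, M. Coste, M.-F. Roy, *Real Algebraic Geometry* (1998), §2.2.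
-/

noncomputable section

-- `Summit.KontsevichZagierPeriods.KontsevichZagierPeriods.…` is the tree's mandated layout (single-conjunct summit).
set_option linter.dupNamespace false

namespace Summit.KontsevichZagierPeriods.KontsevichZagierPeriods.AyoubPiCancellationLine

open Set MeasureTheory
open Literature.NumberTheory.Transcendental
open Literature.NumberTheory.Transcendental.KZ
open Literature.ModelTheory.ExponentialFields (IsSemialgebraic isSemialgebraic_setOf_eval_le)
open MvPolynomial (X C)
open Summit.KontsevichZagierPeriods.KontsevichZagierPeriods.BetaCancellationLine
  (weightExists_isSemialgebraicFunOn_coord weightExists_measurable)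

-- adapted from Summits/KontsevichZagierPeriods/KontsevichZagierPeriods/Theorems/LiouvilleUnfoldingAyoubPiCancellationStubStripConst.lean
-- (the Newton–Leibniz move along the last coordinate of a disc fibration, and the cut by rule (1))

/-! ## Semialgebraic sets, boxes, null sets -/

/-- The closed spread solid `{(q, x, y) : a' ≤ q ≤ b', x² + y² ≤ 1, x ≤ q} ⊆ ℝ³` is
`ℚ`-semialgebraic (polynomial inequalities with rational coefficients). [folklore] -/
theorem spreadSolidReduce_isSemialgebraic_solid (a' b' : ℚ) :
    IsSemialgebraic ℚ {z : Fin 3 → ℝ | ((a' : ℝ) ≤ z 0 ∧ z 0 ≤ b') ∧ z 1 ^ 2 + z 2 ^ 2 ≤ 1 ∧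
      z 1 ≤ z 0} := by
  have h1 : IsSemialgebraic ℚ {z : Fin 3 → ℝ | (a' : ℝ) ≤ z 0} := by
    simpa using isSemialgebraic_setOf_eval_le (k := ℚ) (R := ℝ) (C a') (X (0 : Fin 3))
  have h2 : IsSemialgebraic ℚ {z : Fin 3 → ℝ | z 0 ≤ (b' : ℝ)} := by
    simpa using isSemialgebraic_setOf_eval_le (k := ℚ) (R := ℝ) (X (0 : Fin 3)) (C b')
  have h3 : IsSemialgebraic ℚ {z : Fin 3 → ℝ | z 1 ^ 2 + z 2 ^ 2 ≤ 1} := by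
    have := isSemialgebraic_setOf_eval_le (k := ℚ) (R := ℝ)
      (X 1 ^ 2 + X 2 ^ 2 : MvPolynomial (Fin 3) ℚ) 1
    simpa using this
  have h4 : IsSemialgebraic ℚ {z : Fin 3 → ℝ | z 1 ≤ z 0} := by
    simpa using isSemialgebraic_setOf_eval_le (k := ℚ) (R := ℝ) (X (1 : Fin 3)) (X 0)
  convert (h1.inter h2).inter (h3.inter h4) using 1
  ext z
  simp only [mem_inter_iff, mem_setOf_eq]

/-- The base `T = {(q, x) : a' ≤ q ≤ b', -1 ≤ x ≤ q} ⊆ ℝ²` of the Newton–Leibniz move is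
`ℚ`-semialgebraic. [folklore] -/
theorem spreadSolidReduce_isSemialgebraic_base (a' b' : ℚ) :
    IsSemialgebraic ℚ {z : Fin 2 → ℝ | ((a' : ℝ) ≤ z 0 ∧ z 0 ≤ b') ∧ -1 ≤ z 1 ∧ z 1 ≤ z 0} := by
  have h1 : IsSemialgebraic ℚ {z : Fin 2 → ℝ | (a' : ℝ) ≤ z 0} := by
    simpa using isSemialgebraic_setOf_eval_le (k := ℚ) (R := ℝ) (C a') (X (0 : Fin 2))
  have h2 : IsSemialgebraic ℚ {z : Fin 2 → ℝ | z 0 ≤ (b' : ℝ)} := by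
    simpa using isSemialgebraic_setOf_eval_le (k := ℚ) (R := ℝ) (X (0 : Fin 2)) (C b')
  have h3 : IsSemialgebraic ℚ {z : Fin 2 → ℝ | -1 ≤ z 1} := by
    simpa using isSemialgebraic_setOf_eval_le (k := ℚ) (R := ℝ) (-1) (X (1 : Fin 2))
  have h4 : IsSemialgebraic ℚ {z : Fin 2 → ℝ | z 1 ≤ z 0} := by
    simpa using isSemialgebraic_setOf_eval_le (k := ℚ) (R := ℝ) (X (1 : Fin 2)) (X 0)
  convert (h1.inter h2).inter (h3.inter h4) using 1
  ext z
  simp only [mem_inter_iff, mem_setOf_eq]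

/-- The closed spread solid of an interior interval lies in the cube `[-1, 1]³`. [folklore] -/
theorem spreadSolidReduce_solid_subset_Icc {a' b' : ℚ} (ha : -1 < a') (hb : b' < 1) :
    {z : Fin 3 → ℝ | ((a' : ℝ) ≤ z 0 ∧ z 0 ≤ b') ∧ z 1 ^ 2 + z 2 ^ 2 ≤ 1 ∧ z 1 ≤ z 0} ⊆
      Icc (fun _ => (-1 : ℝ)) (fun _ => 1) := by
  rintro z ⟨⟨h0a, h0b⟩, hd, -⟩
  have ha' : (-1 : ℝ) < a' := by exact_mod_cast ha
  have hb' : ((b' : ℚ) : ℝ) < 1 := by exact_mod_cast hb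
  have h1 : z 1 ^ 2 ≤ 1 ^ 2 := by nlinarith [sq_nonneg (z 2)]
  have h2 : z 2 ^ 2 ≤ 1 ^ 2 := by nlinarith [sq_nonneg (z 1)]
  have h1' := abs_le_of_sq_le_sq' h1 zero_le_one
  have h2' := abs_le_of_sq_le_sq' h2 zero_le_one
  rw [mem_Icc, Pi.le_def, Pi.le_def]
  constructor <;> intro i <;> fin_cases i
  exacts [show -1 ≤ z 0 by linarith, h1'.1, h2'.1, show z 0 ≤ 1 by linarith, h1'.2, h2'.2]

/-- The base `T` of an interior interval lies in the square `[-1, 1]²`. [folklore] -/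
theorem spreadSolidReduce_base_subset_Icc {a' b' : ℚ} (ha : -1 < a') (hb : b' < 1) :
    {z : Fin 2 → ℝ | ((a' : ℝ) ≤ z 0 ∧ z 0 ≤ b') ∧ -1 ≤ z 1 ∧ z 1 ≤ z 0} ⊆
      Icc (fun _ => (-1 : ℝ)) (fun _ => 1) := by
  rintro z ⟨⟨h0a, h0b⟩, h1, h10⟩
  have ha' : (-1 : ℝ) < a' := by exact_mod_cast ha
  have hb' : ((b' : ℚ) : ℝ) < 1 := by exact_mod_cast hb
  rw [mem_Icc, Pi.le_def, Pi.le_def]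
  constructor <;> intro i <;> fin_cases i
  exacts [show -1 ≤ z 0 by linarith, show -1 ≤ z 1 by linarith, show z 0 ≤ 1 by linarith,
    show z 1 ≤ 1 by linarith]

/-- A measurable function with a uniform bound is absolutely integrable on every subset of the
cube `[-1, 1]ⁿ` (a set of finite Lebesgue measure). [folklore] -/
theorem spreadSolidReduce_integrableOn_of_bound {n : ℕ} {s : Set (Fin n → ℝ)}
    {f : (Fin n → ℝ) → ℝ} (hs : s ⊆ Icc (fun _ => (-1 : ℝ)) (fun _ => 1)) (hf : Measurable f)
    {B : ℝ} (hB : ∀ z, |f z| ≤ B) : IntegrableOn f s :=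
  IntegrableOn.of_bound ((measure_mono hs).trans_lt isCompact_Icc.measure_lt_top)
    hf.aestronglyMeasurable B (Filter.Eventually.of_forall fun z => by
      rw [Real.norm_eq_abs]
      exact hB z)

/-- The diagonal hyperplane `{x = q} = {z 1 = z 0} ⊆ ℝ³` is Lebesgue-null (the zero set of the
non-zero polynomial `X₁ − X₀`). [folklore] -/
theorem spreadSolidReduce_volume_diag : volume {z : Fin 3 → ℝ | z 1 = z 0} = 0 := by
  have hp : (X 1 - X 0 : MvPolynomial (Fin 3) ℝ) ≠ 0 := by
    intro h
    have := congrArg (MvPolynomial.eval (fun i : Fin 3 => (i : ℝ))) h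
    simp at this
  simpa [sub_eq_zero] using MvPolynomial.volume_zeroSet_eq_zero 3 (X 1 - X 0) hp

/-! ## Semialgebraic functions on the base, and the bound of the plane-stage integrand -/

/-- The chord half-length `(q, x) ↦ √(1 − x²)` is `ℚ`-semialgebraic on the base `T` (the square
root of a polynomial; Tarski–Seidenberg). [folklore] -/
theorem spreadSolidReduce_isSemialgebraicFunOn_edge (a' b' : ℚ) :
    IsSemialgebraicFunOn ℚ {z : Fin 2 → ℝ | ((a' : ℝ) ≤ z 0 ∧ z 0 ≤ b') ∧ -1 ≤ z 1 ∧ z 1 ≤ z 0}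
      (fun z => Real.sqrt (1 - z 1 ^ 2)) :=
  (IsSemialgebraicFunOn.sqrt_holds (isSemialgebraicFunOn_aeval
    (spreadSolidReduce_isSemialgebraic_base a' b') (1 - X 1 ^ 2 : MvPolynomial (Fin 2) ℚ))).congr
    fun x _ => by simp

/-- The plane-stage integrand `(q, x) ↦ 2√(1 − x²) · w(q)` is `ℚ`-semialgebraic on the base `T`
for a weight `w` which is `ℚ`-semialgebraic on `ℝ¹` (products of semialgebraic functions;
Tarski–Seidenberg). [folklore] -/
theorem spreadSolidReduce_isSemialgebraicFunOn_chordWeight (a' b' : ℚ) {w : ℝ → ℝ}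
    (hw : IsSemialgebraicFunOn ℚ (Set.univ : Set (Fin 1 → ℝ)) (fun x => w (x 0))) :
    IsSemialgebraicFunOn ℚ {z : Fin 2 → ℝ | ((a' : ℝ) ≤ z 0 ∧ z 0 ≤ b') ∧ -1 ≤ z 1 ∧ z 1 ≤ z 0}
      (fun z => 2 * Real.sqrt (1 - z 1 ^ 2) * w (z 0)) := by
  have hT := spreadSolidReduce_isSemialgebraic_base a' b'
  have h2 : IsSemialgebraicFunOn ℚ
      {z : Fin 2 → ℝ | ((a' : ℝ) ≤ z 0 ∧ z 0 ≤ b') ∧ -1 ≤ z 1 ∧ z 1 ≤ z 0}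
      (fun z => 2 * Real.sqrt (1 - z 1 ^ 2)) :=
    (IsSemialgebraicFunOn.mul_holds (isSemialgebraicFunOn_natCast hT 2)
      (spreadSolidReduce_isSemialgebraicFunOn_edge a' b')).congr fun x _ => by simp
  exact (IsSemialgebraicFunOn.mul_holds h2 ((weightExists_isSemialgebraicFunOn_coord hw
    (0 : Fin 2)).mono (subset_univ _) hT)).congr fun x _ => rfl

/-- The plane-stage integrand is bounded by `2C` if `|w| ≤ C` (`0 ≤ √(1 − x²) ≤ 1`). [folklore] -/
theorem spreadSolidReduce_abs_chordWeight_le {w : ℝ → ℝ} {C : ℝ} (hC : ∀ t : ℝ, |w t| ≤ C)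
    (z : Fin 2 → ℝ) : |2 * Real.sqrt (1 - z 1 ^ 2) * w (z 0)| ≤ 2 * C := by
  have hs1 : Real.sqrt (1 - z 1 ^ 2) ≤ 1 := Real.sqrt_le_one.2 (by nlinarith [sq_nonneg (z 1)])
  have hwC := hC (z 0)
  rw [abs_mul, abs_mul, abs_of_pos (two_pos : (0 : ℝ) < 2), abs_of_nonneg (Real.sqrt_nonneg _)]
  nlinarith [mul_nonneg (sub_nonneg.2 hs1) (abs_nonneg (w (z 0))), Real.sqrt_nonneg (1 - z 1 ^ 2)]

/-! ## The moves -/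

/-- **The cut of the wall positions to the slab `(a', b')`** (printed rule (1)): for a weight
vanishing off `(a', b')`, `[V] − [V|(a',b')]` is a relation, the complement piece
`[V|off (a',b')]` having zero integrand. [folklore] -/
theorem spreadSolidReduce_of_sub_of_slabRestrict_mem {a' b' : ℚ} {w : ℝ → ℝ}
    (hw0 : ∀ t : ℝ, t ∉ Set.Ioo (a' : ℝ) b' → w t = 0) (V : IntegralRep 3)
    (hVi : V.integrand = fun z => w (z 0)) :
    of V - of (V.slabRestrict a' b') ∈ relations := by
  have h1 : of V - of (V.slabRestrict a' b') - of (V.slabCompl a' b') ∈ relations :=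
    domainAddRel_subset_relations (IntegralRep.of_sub_of_slabRestrict_sub_of_slabCompl_mem V a' b')
  have h2 : of (V.slabCompl a' b') ∈ relations := by
    refine of_mem_relations_of_eqOn_zero _ fun z hz => ?_
    rw [IntegralRep.domain_slabCompl, mem_sdiff, mem_paramSlab] at hz
    rw [IntegralRep.integrand_slabCompl, hVi]
    exact hw0 (z 0) hz.2
  have : of V - of (V.slabRestrict a' b') =
      (of V - of (V.slabRestrict a' b') - of (V.slabCompl a' b')) + of (V.slabCompl a' b') := by
    abel
  rw [this]
  exact relations.add_mem h1 h2

/-- **Closing the spread solid** (printed rule (1) with a null piece): for `a < a'`, `b' < b`, the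
slab restriction `V|(a',b')` of a representation `V` of the weighted spread solid over `(a, b)` is
the restriction of any representation `V_cl` of the closed spread solid over `[a', b']` with the
same integrand to a co-null `ℚ`-semialgebraic subset (the difference lies in the hyperplanes
`{x = q}`, `{q = a'}`, `{q = b'}`), so `[V_cl] − [V|(a',b')]` is a relation. [folklore] -/
theorem spreadSolidReduce_of_sub_of_slabRestrict_mem_of_close {a b a' b' : ℚ} (haa : a < a')
    (hbb : b' < b) (Vcl V : IntegralRep 3)
    (hcd : Vcl.domain = {z : Fin 3 → ℝ | ((a' : ℝ) ≤ z 0 ∧ z 0 ≤ b') ∧ z 1 ^ 2 + z 2 ^ 2 ≤ 1 ∧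
      z 1 ≤ z 0})
    (hVd : V.domain = {z : Fin 3 → ℝ | ((a : ℝ) < z 0 ∧ z 0 < b) ∧ z 1 ^ 2 + z 2 ^ 2 ≤ 1 ∧
      z 1 < z 0})
    (hi : Vcl.integrand = V.integrand) :
    of Vcl - of (V.slabRestrict a' b') ∈ relations := by
  have haa' : ((a : ℚ) : ℝ) < a' := by exact_mod_cast haa
  have hbb' : ((b' : ℚ) : ℝ) < b := by exact_mod_cast hbb
  have hsub : (V.slabRestrict a' b').domain ⊆ Vcl.domain := by
    rw [IntegralRep.domain_slabRestrict, hVd, hcd]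
    rintro z ⟨⟨-, hd, h10⟩, hs⟩
    rw [mem_paramSlab] at hs
    exact ⟨⟨hs.1.le, hs.2.le⟩, hd, h10.le⟩
  -- the coordinate hyperplanes `{q = c}` are null (`ZhangJiangXie2025.volume_hyperplane`, inlined)
  have hwall : ∀ c : ℝ, volume {z : Fin 3 → ℝ | z 0 = c} = 0 := fun c => by
    rw [MeasureTheory.volume_pi]
    exact Measure.pi_hyperplane _ 0 _
  have hvol : volume (Vcl.domain \ (V.slabRestrict a' b').domain) = 0 := by
    refine measure_mono_null (fun z hz => ?_) (measure_union_null
      (measure_union_null spreadSolidReduce_volume_diag (hwall a')) (hwall b'))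
    rw [IntegralRep.domain_slabRestrict, hVd, hcd] at hz
    obtain ⟨⟨⟨h0a, h0b⟩, hd, h10⟩, hz2⟩ := hz
    simp only [mem_union, mem_setOf_eq]
    by_contra hcon
    push Not at hcon
    obtain ⟨⟨h1, h2⟩, h3⟩ := hcon
    have h0a' : (a' : ℝ) < z 0 := lt_of_le_of_ne h0a (Ne.symm h2)
    have h0b' : z 0 < (b' : ℝ) := lt_of_le_of_ne h0b h3
    exact hz2 ⟨⟨⟨by linarith, by linarith⟩, hd, lt_of_le_of_ne h10 h1⟩,
      mem_paramSlab.2 ⟨h0a', h0b'⟩⟩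
  have h := Vcl.of_sub_of_restrict_mem_relations (V.slabRestrict a' b').isSemialgebraic_domain
    hsub hvol
  have heq : Vcl.restrict _ (V.slabRestrict a' b').isSemialgebraic_domain hsub =
      V.slabRestrict a' b' :=
    IntegralRep.ext' rfl
      (by rw [IntegralRep.integrand_restrict, IntegralRep.integrand_slabRestrict, hi])
  rwa [heq] at h

/-- **`V_cl − K₂` is one Newton–Leibniz move along `y`** (for any representations `V_cl`, `K₂`
with these domains and integrands): base `T = {(q, x) : a' ≤ q ≤ b', -1 ≤ x ≤ q}`, edges
`-√(1 − x²) ≤ √(1 − x²)`, primitive `F (q, x, y) = y · w(q)` (`∂F/∂y = w(q)`,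
`F (q, x, √(1 − x²)) − F (q, x, −√(1 − x²)) = 2√(1 − x²) · w(q)`); the closed spread solid is the
band `{−√(1 − x²) ≤ y ≤ √(1 − x²)}` over `T` since `x ≤ q ≤ b' < 1`.
[cite: KontsevichZagier2001, §1.2 rule (3)] -/
theorem spreadSolidReduce_of_sub_of_mem_newtonLeibnizRel {a' b' : ℚ} (hb : b' < 1) {w : ℝ → ℝ}
    (hw : IsSemialgebraicFunOn ℚ (Set.univ : Set (Fin 1 → ℝ)) (fun x => w (x 0)))
    (V : IntegralRep 3) (K : IntegralRep 2)
    (hVd : V.domain = {z : Fin 3 → ℝ | ((a' : ℝ) ≤ z 0 ∧ z 0 ≤ b') ∧ z 1 ^ 2 + z 2 ^ 2 ≤ 1 ∧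
      z 1 ≤ z 0})
    (hVi : V.integrand = fun z => w (z 0))
    (hKd : K.domain = {z : Fin 2 → ℝ | ((a' : ℝ) ≤ z 0 ∧ z 0 ≤ b') ∧ -1 ≤ z 1 ∧ z 1 ≤ z 0})
    (hKi : K.integrand = fun z => 2 * Real.sqrt (1 - z 1 ^ 2) * w (z 0)) :
    of V - of K ∈ newtonLeibnizRel := by
  refine ⟨2, V, K, fun x => -Real.sqrt (1 - x 1 ^ 2), fun x => Real.sqrt (1 - x 1 ^ 2),
    fun z => z (Fin.last 2) * w (z 0), ?_, ?_, ?_, ?_, ?_, ?_, ?_, ?_, rfl⟩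
  · -- `F (q, x, y) = y · w(q)` (a coordinate times the weight) is semialgebraic on the solid
    exact (IsSemialgebraicFunOn.mul_holds (isSemialgebraicFunOn_aeval V.isSemialgebraic_domain
      (X (Fin.last 2) : MvPolynomial (Fin 3) ℚ))
      ((weightExists_isSemialgebraicFunOn_coord hw (0 : Fin 3)).mono (subset_univ _)
        V.isSemialgebraic_domain)).congr fun z _ => by simp
  · -- the lower edge
    rw [hKd]
    exact (spreadSolidReduce_isSemialgebraicFunOn_edge a' b').neg
  · -- the upper edge
    rw [hKd]
    exact spreadSolidReduce_isSemialgebraicFunOn_edge a' b'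
  · -- `-√ ≤ √` on the base
    intro x _
    have hu := Real.sqrt_nonneg (1 - x 1 ^ 2)
    linarith
  · -- the closed spread solid is the band `{-√(1 - x²) ≤ y ≤ √(1 - x²)}` over the base
    rw [hVd, hKd]
    ext z
    have e0 : Fin.init z 0 = z 0 := rfl
    have e1 : Fin.init z 1 = z 1 := rfl
    have e2 : z (Fin.last 2) = z 2 := rfl
    have hb' : ((b' : ℚ) : ℝ) < 1 := by exact_mod_cast hb
    simp only [mem_setOf_eq, e0, e1, e2]
    constructor
    · rintro ⟨h0, hd, h10⟩
      have h1 : z 1 ^ 2 ≤ 1 ^ 2 := by nlinarith [sq_nonneg (z 2)]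
      have hnn : 0 ≤ 1 - z 1 ^ 2 := by nlinarith [sq_nonneg (z 2)]
      have h4 : z 2 ^ 2 ≤ Real.sqrt (1 - z 1 ^ 2) ^ 2 := by
        rw [Real.sq_sqrt hnn]
        linarith
      exact ⟨⟨h0, (abs_le_of_sq_le_sq' h1 zero_le_one).1, h10⟩,
        abs_le_of_sq_le_sq' h4 (Real.sqrt_nonneg _)⟩
    · rintro ⟨⟨h0, h1, h10⟩, h3, h4⟩
      have hz1 : z 1 ≤ 1 := by linarith [h0.2]
      have hnn : 0 ≤ 1 - z 1 ^ 2 := by nlinarith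
      have h5 := sq_le_sq' h3 h4
      rw [Real.sq_sqrt hnn] at h5
      exact ⟨h0, by linarith, h10⟩
  · -- continuity of `y ↦ F (q, x, y) = y · w(q)` on the closed fibre
    intro x _
    simp only [Fin.snoc_last, Fin.snoc_apply_zero]
    fun_prop
  · -- `∂F/∂y = w(q)` is the integrand of `V_cl`
    intro x _ t _
    have h : HasDerivAt (fun s : ℝ => s * w (x 0)) (1 * w (x 0)) t := (hasDerivAt_id' t).mul_const _
    rw [one_mul] at h
    simpa only [Fin.snoc_last, Fin.snoc_apply_zero, hVi] using h
  · -- the boundary term is the plane-stage integrand: `2√(1 - x²) · w(q) = √·w − (−√)·w`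
    intro x _
    simp only [Fin.snoc_last, Fin.snoc_apply_zero, hKi]
    ring

/-! ## The reduction -/

/-- **The weighted spread solid reduces to the plane stage**, for a general bounded weight `w` of
the wall position, `ℚ`-semialgebraic on `ℝ¹` and vanishing off `(a', b')`: the plane stage
`K = [{(x, q) : -1 ≤ x ≤ q, a' ≤ q ≤ b'}, 2√(1 − x²) · w(q)]` (the coordinate swap of the base stage
`K₂`) is equivalent to every representation of `[{a < q < b, x² + y² ≤ 1, x < q}, w(q)]`: cut to
the slab, close the solid (null difference), Newton–Leibniz along `y`, swap `(q, x) ↦ (x, q)`.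
[folklore] -/
theorem spreadSolidReduce_of_weight {a b a' b' : ℚ} (haa : a < a') (hbb : b' < b)
    (ha : -1 < a') (hb : b' < 1) {w : ℝ → ℝ}
    (hw : IsSemialgebraicFunOn ℚ (Set.univ : Set (Fin 1 → ℝ)) (fun x => w (x 0)))
    {C : ℝ} (hC : ∀ t : ℝ, |w t| ≤ C) (hw0 : ∀ t : ℝ, t ∉ Set.Ioo (a' : ℝ) b' → w t = 0) :
    ∃ K : IntegralRep 2,
      K.domain = {z : Fin 2 → ℝ | (-1 ≤ z 0 ∧ z 0 ≤ z 1) ∧ ((a' : ℝ) ≤ z 1 ∧ z 1 ≤ b')} ∧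
      (K.integrand = fun z => 2 * Real.sqrt (1 - z 0 ^ 2) * w (z 1)) ∧
      ∀ (Vw : IntegralRep 3),
        Vw.domain = {z : Fin 3 → ℝ | ((a : ℝ) < z 0 ∧ z 0 < b) ∧ z 1 ^ 2 + z 2 ^ 2 ≤ 1 ∧
          z 1 < z 0} →
        (Vw.integrand = fun z => w (z 0)) → Equivalent Vw K := by
  have hwm : Measurable w := weightExists_measurable hw
  -- the closed spread solid over `[a', b']`, weighted by `w(q)`
  let Vcl : IntegralRep 3 :=
    ⟨{z : Fin 3 → ℝ | ((a' : ℝ) ≤ z 0 ∧ z 0 ≤ b') ∧ z 1 ^ 2 + z 2 ^ 2 ≤ 1 ∧ z 1 ≤ z 0},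
      fun z => w (z 0), spreadSolidReduce_isSemialgebraic_solid a' b',
      (weightExists_isSemialgebraicFunOn_coord hw (0 : Fin 3)).mono (subset_univ _)
        (spreadSolidReduce_isSemialgebraic_solid a' b'),
      spreadSolidReduce_integrableOn_of_bound (spreadSolidReduce_solid_subset_Icc ha hb)
        (hwm.comp (measurable_pi_apply 0)) fun z => hC (z 0)⟩
  -- the base stage `K₂ = [T, 2√(1 − x²) w(q)]` in the coordinates `(q, x)`
  let K₂ : IntegralRep 2 :=
    ⟨{z : Fin 2 → ℝ | ((a' : ℝ) ≤ z 0 ∧ z 0 ≤ b') ∧ -1 ≤ z 1 ∧ z 1 ≤ z 0},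
      fun z => 2 * Real.sqrt (1 - z 1 ^ 2) * w (z 0), spreadSolidReduce_isSemialgebraic_base a' b',
      spreadSolidReduce_isSemialgebraicFunOn_chordWeight a' b' hw,
      spreadSolidReduce_integrableOn_of_bound (spreadSolidReduce_base_subset_Icc ha hb)
        ((show Measurable fun z : Fin 2 → ℝ => 2 * Real.sqrt (1 - z 1 ^ 2) by fun_prop).mul
          (hwm.comp (measurable_pi_apply 0)))
        (spreadSolidReduce_abs_chordWeight_le hC)⟩
  refine ⟨K₂.reindex (Equiv.swap (0 : Fin 2) 1), ?_, ?_, fun Vw hVwd hVwi => ?_⟩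
  · -- the domain of the plane stage, in the coordinates `(x, q)`
    ext z
    show (fun i => z (Equiv.swap (0 : Fin 2) 1 i)) ∈
        {z : Fin 2 → ℝ | ((a' : ℝ) ≤ z 0 ∧ z 0 ≤ b') ∧ -1 ≤ z 1 ∧ z 1 ≤ z 0} ↔ _
    simp only [mem_setOf_eq, Equiv.swap_apply_left, Equiv.swap_apply_right]
    exact and_comm
  · -- the integrand of the plane stage, in the coordinates `(x, q)`
    funext z
    show 2 * Real.sqrt (1 - z (Equiv.swap (0 : Fin 2) 1 1) ^ 2) *
        w (z (Equiv.swap (0 : Fin 2) 1 0)) = _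
    rw [Equiv.swap_apply_left, Equiv.swap_apply_right]
  · -- the chain `V_w ∼ V_w|(a',b') ∼ V_cl ∼ K₂ ∼ K₂.reindex (swap 0 1)`
    have h1 : of Vw - of (Vw.slabRestrict a' b') ∈ relations :=
      spreadSolidReduce_of_sub_of_slabRestrict_mem hw0 Vw hVwi
    have h2 : of Vcl - of (Vw.slabRestrict a' b') ∈ relations :=
      spreadSolidReduce_of_sub_of_slabRestrict_mem_of_close haa hbb Vcl Vw rfl hVwd
        (by rw [hVwi])
    have h3 : of Vcl - of K₂ ∈ relations := newtonLeibnizRel_subset_relations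
      (spreadSolidReduce_of_sub_of_mem_newtonLeibnizRel hb hw Vcl K₂ rfl rfl rfl rfl)
    have h4 : of K₂ - of (K₂.reindex (Equiv.swap (0 : Fin 2) 1)) ∈ relations :=
      of_sub_of_reindex_mem_relations K₂ _
    have key : of Vw - of (K₂.reindex (Equiv.swap (0 : Fin 2) 1)) =
        (of Vw - of (Vw.slabRestrict a' b')) - (of Vcl - of (Vw.slabRestrict a' b')) +
          (of Vcl - of K₂) + (of K₂ - of (K₂.reindex (Equiv.swap (0 : Fin 2) 1))) := by
      abel
    show of Vw - of (K₂.reindex (Equiv.swap (0 : Fin 2) 1)) ∈ relations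
    rw [key]
    exact relations.add_mem (relations.add_mem (relations.sub_mem h1 h2) h3) h4

/-- **STUB `stub_spreadSolidReduce`** (M) of the line `Sketch` (v6): the weighted spread solid
`[{(q, x, y) : a < q < b, x² + y² ≤ 1, x < q}, h_{a',b'}(q)]` of the zero-mean spread weight
`h_{a',b'} = 𝟙_{(a',b')} · ((2t − (a'+b'))(1 − t²) + t (t − a')(t − b')) / (2 (1 − t²) √(1 − t²))`
of an interior interval `a < a' < b' < b`, `-1 < a' < b' < 1`, reduces to the plane stage
`K = [{(x, q) : -1 ≤ x ≤ q, a' ≤ q ≤ b'}, 2√(1 − x²) · h_{a',b'}(q)]`; the admissibility of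
`h_{a',b'}` (semialgebraic on `ℝ¹`, bounded) is a hypothesis, and `h_{a',b'}` vanishes off
`(a', b')` by construction (`spreadSolidReduce_of_weight`). [folklore] -/
theorem stub_spreadSolidReduce : ∀ (a b a' b' : ℚ), a < a' → a' < b' → b' < b → -1 < a' → b' < 1 →
    IsSemialgebraicFunOn ℚ (Set.univ : Set (Fin 1 → ℝ))
        (fun x => (Set.Ioo (a' : ℝ) b').indicator (fun t => ((2 * t - (a' + b')) * (1 - t ^ 2) +
          t * ((t - a') * (t - b'))) / (2 * (1 - t ^ 2) * Real.sqrt (1 - t ^ 2))) (x 0)) →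
    ∀ (C : ℝ), (∀ t : ℝ, |(Set.Ioo (a' : ℝ) b').indicator (fun t => ((2 * t - (a' + b')) * (1 - t ^ 2) +
          t * ((t - a') * (t - b'))) / (2 * (1 - t ^ 2) * Real.sqrt (1 - t ^ 2))) t| ≤ C) →
    ∃ K : IntegralRep 2,
      K.domain = {z : Fin 2 → ℝ | (-1 ≤ z 0 ∧ z 0 ≤ z 1) ∧ ((a' : ℝ) ≤ z 1 ∧ z 1 ≤ b')} ∧
      (K.integrand = fun z => 2 * Real.sqrt (1 - z 0 ^ 2) *
        (Set.Ioo (a' : ℝ) b').indicator (fun t => ((2 * t - (a' + b')) * (1 - t ^ 2) +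
          t * ((t - a') * (t - b'))) / (2 * (1 - t ^ 2) * Real.sqrt (1 - t ^ 2))) (z 1)) ∧
      ∀ (Vw : IntegralRep 3),
        Vw.domain = {z : Fin 3 → ℝ | ((a : ℝ) < z 0 ∧ z 0 < b) ∧ z 1 ^ 2 + z 2 ^ 2 ≤ 1 ∧ z 1 < z 0} →
        (Vw.integrand = fun z => (Set.Ioo (a' : ℝ) b').indicator (fun t => ((2 * t - (a' + b')) *
          (1 - t ^ 2) + t * ((t - a') * (t - b'))) / (2 * (1 - t ^ 2) * Real.sqrt (1 - t ^ 2))) (z 0)) →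
        Equivalent Vw K :=
  fun _ _ _ _ haa _ hbb ha hb hw _ hC =>
    spreadSolidReduce_of_weight haa hbb ha hb hw hC fun _ ht => indicator_of_notMem ht _

end Summit.KontsevichZagierPeriods.KontsevichZagierPeriods.AyoubPiCancellationLine
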